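import Summits.HodgeConjecture.CorCM.IrreducibleOddWeightsOrbitBalance
import Summits.HodgeConjecture.CorCM.IrreducibleOddWeightsSeparatedSlots
import HarnessLib

/-!
# ORBIT BALANCE (families): vanishing sums of translates of the type vectors along the kernels of the other slots force
# `Hg(∏_i A_i) = ∏_i Hg(A_i)` — hereditary through the minimal non-additive sub-family

COR-CM (cell `pub-hodgecm2`, binder seat `b16` gen 62, count-neutral claim ORBIT BALANCE, file O2 — abstract `G`-set
level; theorems only, no definition, no named fact, no `sorry`).  NEW as stated, hence under `Summits/`.  HONEST FRAMING:
unconditional finite-dimensional linear algebra over `ℚ` about the rank of families of CM types (on Mumford–Tate groups: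
`Hg(∏_i A_i) = ∏_i Hg(A_i)`); `HC_CM` is neither used nor asserted.  Sequel of file O1 (`…OrbitBalance`, pairs).

THE MECHANISM.  A MINIMAL non-additive sub-family `T₀` has ONE irreducible `V` which is a quotient of `U(Φ_j)` for every
`j ∈ T₀` (gen 59 F10 `exists_forall_evalSpace_ne_bot_of_minimal_nonadditive`), so `V` is fixed pointwise by the kernel
`N_j` of the action of `G` on `E_j` for every `j ∈ T₀`, hence by `Γ_i = ⟨N_j : j ∈ T₀, j ≠ i⟩` for each `i ∈ T₀`.  If the
type vector `u_i` of some member has a vanishing non-empty sum of `Γ_i`-translates, `Σ_k γ_k·u_i = 0`, then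
`(n+1)·T_i(u_i) = T_i(Σ_k γ_k·u_i) = 0` for every equivariant `T_i : ℚ^{E_i} → V` — contradiction.  Hence:

* **`finrank_antiSpan_sigmaType_eq_sum_of_closure_kernels`** (hereditary form) — if every sub-family `T` with `|T| ≥ 2`
  has a member `i` with a vanishing sum of `⟨N_j : j ∈ T ∖ i⟩`-translates of `u_i`, then `dim U(Σ) = Σ_i dim U(Φ_i)`
  (ARBITRARY subsets `Φ_i`, no CM hypothesis);
* **`finrank_antiSpan_sigmaType_eq_sum_of_pairwise_kernel`** — it suffices that for every pair `i ≠ j` ONE of `u_i`,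
  `u_j` has a vanishing sum of translates by elements acting trivially on the OTHER slot; orbit form
  **`finrank_antiSpan_sigmaType_eq_sum_of_pairwise_orbit_sums_eq_zero`** (`Φ_i` EQUIDISTRIBUTED along the orbits of a
  subgroup acting trivially on `E_j`: every orbit meets `Φ_i` in half of its points); rank forms
  `typeRank_sigmaType_add_card_eq_of_pairwise_kernel` (`rank(Σ) + |I| = Σ_i rank(Φ_i) + 1`),
  `typeRank_sigmaType_eq_iff_forall_of_pairwise_kernel` (nondegenerate iff every member is);
* `pairwise_kernel_of_pairwise_separated` — gen 59 F10 («pairwise `ρ`-separated slots»: some `τ` is `ρ` on `E_i` and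
  trivial on `E_j`, i.e. the Galois closures meet in a totally real field) is the two-term case `u + τ·u = 0`.
For `G = Aut(ℂ)`, `N_j = Aut(ℂ/L_j)` (`L_j` the Galois closure of `K_j`) and «`Φ_i` equidistributed along the
`N_j`-orbits» reads «`Φ_i` is equidistributed over `K_i ∩ L_j`»: the new cases are CM fields whose Galois closures meet
in a CM field over (a Galois subfield of `K_i` containing) which `Φ_i` is equidistributed — the POSITIVE complement of the
tree's `SharedImaginaryQuadratic*` / `SharedOddCharacter*` / `CommonAbelianCMSubfieldDegenerate` (file O3).

## References

* [Gordon1999HodgeAVSurvey] B. B. Gordon, *A survey of the Hodge conjecture for abelian varieties*, §3 Theorem (Imai,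
  Murty) with proof, 7.5–7.7.
* [MoonenZarhin1999LowDim] B. Moonen, Yu. Zarhin, *Hodge classes on abelian varieties of low dimension*, Math. Ann.
  315 (1999), §3 (3.1).
* [Mai1989] L. Mai, *Lower bounds for the ranks of CM types*, J. Number Theory 32 (1989), §2 Prop. 1 (proof).
* [Serre1977] J.-P. Serre, *Linear Representations of Finite Groups*, GTM 42, §2.2 Prop. 4 (Schur).
* [Deligne1982HodgeCycles] P. Deligne, *Hodge cycles on abelian varieties*, LNM 900 (1982), I Ex. 3.7 (c).
-/

set_option autoImplicit false

noncomputable section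

open scoped BigOperators

universe u u' v w

namespace Summit.HodgeConjecture.CorCM

namespace IrrOdd

open Literature.NumberTheory.ComplexMultiplication

variable {G : Type w} [Group G]

/-- The evaluation space `Ev[G, π, w] = {T w : T equivariant}` (local notation, no definition). -/
local notation3 (prettyPrint := false) "Ev[" G' ", " π ", " w "]" =>
  Submodule.span ℚ {v | ∃ T : (_ → ℚ) →ₗ[ℚ] _,
    (∀ (g : G') (f : _ → ℚ), T (fun x => f (g⁻¹ • x)) = π g (T f)) ∧ T w = v}

variable {I : Type u} {E : I → Type v} [∀ i, MulAction G (E i)] [Fintype I] [DecidableEq I] [∀ i, Fintype (E i)]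

/-! ### §2 Families, kernel level: translates along the kernels of the other slots -/

omit [DecidableEq I] in
/-- **FAMILY ADDITIVITY FROM VANISHING SUMS OF KERNEL TRANSLATES (hereditary form).**  `G` permutes finite slots `E_i`,
`Φ_i ⊆ E_i` ARBITRARY subsets (no CM hypothesis).  Suppose every sub-family `T` with at least two members contains a member
`i` whose type vector `u_1(Φ_i)` has a vanishing non-empty sum of translates `Σ_k γ_k·u_1(Φ_i) = 0` with the `γ_k` in the
subgroup generated by the elements of `G` acting trivially on some OTHER slot `E_j`, `j ∈ T ∖ i`.  THEN the family is
additive: `dim U(Σ) = Σ_i dim U(Φ_i)` (`Hg(∏_i A_i) = ∏_i Hg(A_i)`).  (A minimal non-additive sub-family `T₀` has a common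
irreducible quotient `V` of all `U(Φ_j)`, `j ∈ T₀`; that subgroup acts trivially on `V`, so `(n+1)·T_i(u_i) = 0`.)
[cite: Mai1989, §2 Prop. 1 (proof)] [cite: MoonenZarhin1999LowDim, §3 (3.1)] [cite: Gordon1999HodgeAVSurvey, §3 Theorem (proof) and 7.7] -/
theorem finrank_antiSpan_sigmaType_eq_sum_of_closure_kernels {Φ : ∀ i, Set (E i)}
    (hbal : ∀ T : Finset I, 2 ≤ T.card → ∃ i ∈ T, ∃ (n : ℕ) (γ : Fin (n + 1) → G),
      (∀ k, γ k ∈ Subgroup.closure {g : G | ∃ j ∈ T, j ≠ i ∧ ∀ s : E j, g • s = s}) ∧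
      ∀ x : E i, ∑ k, antiVec (Φ i) (1 : G) ((γ k)⁻¹ • x) = 0) :
    Module.finrank ℚ (antiSpan G (sigmaType Φ)) = ∑ i, Module.finrank ℚ (antiSpan G (Φ i)) := by
  classical
  obtain ⟨n, S, π, K, -, hirr, hne, hcov⟩ := exists_covering_irreducibles_slots (G := G) (E := E)
  -- sub-family additivity and its finite criterion
  have hFT : ∀ T : Finset I,
      (Module.finrank ℚ (antiSpan G (sigmaType fun j : (T : Set I) => Φ j)) =
          ∑ j : (T : Set I), Module.finrank ℚ (antiSpan G (Φ j)) ↔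
        ∀ k : K, Module.finrank ℚ
            (⨆ j : (T : Set I), Ev[G, π k.1, antiVec (Φ j) (1 : G)] : Submodule ℚ (S k.1)) =
          ∑ j : (T : Set I), Module.finrank ℚ Ev[G, π k.1, antiVec (Φ j) (1 : G)]) := fun T =>
    finrank_antiSpan_sigmaType_eq_sum_iff_forall (E := fun j : (T : Set I) => E j) (V := fun k : K => S k.1)
      (fun j => Φ j) (fun k => π k.1) (fun k => hirr k.1)
      (fun k l hkl T' => hne k.1 k.2 l.1 l.2 (fun h' => hkl (Subtype.ext h')) T')
      fun j P _ hP0 hPst => by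
        obtain ⟨k, hk, T', hT', a, ha, ha0⟩ := hcov j P hP0 hPst
        exact ⟨⟨k, hk⟩, T', hT', a, ha, ha0⟩
  -- a non-additive sub-family exists (F8, degree form with `q = Σ_i dim U(Φ_i)`); take one of least cardinality
  by_contra hbad
  have hq : ∀ i, Module.finrank ℚ (antiSpan G (Φ i)) ≤ ∑ j, Module.finrank ℚ (antiSpan G (Φ j)) := fun i =>
    Finset.single_le_sum (f := fun j => Module.finrank ℚ (antiSpan G (Φ j))) (fun j _ => Nat.zero_le _)
      (Finset.mem_univ i)
  have hex : ∃ m, ∃ T : Finset I, T.card = m ∧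
      Module.finrank ℚ (antiSpan G (sigmaType fun j : (T : Set I) => Φ j)) ≠
        ∑ j : (T : Set I), Module.finrank ℚ (antiSpan G (Φ j)) := by
    by_contra hall
    push Not at hall
    exact hbad ((finrank_antiSpan_sigmaType_eq_sum_iff_forall_card_le_of_finrank_antiSpan_le Φ _ hq).2
      fun T _ => hall T.card T rfl)
  obtain ⟨T₀, hT₀card, hT₀⟩ := Nat.find_spec hex
  have hmin : ∀ T : Finset I, T ⊂ T₀ →
      Module.finrank ℚ (antiSpan G (sigmaType fun j : (T : Set I) => Φ j)) =
        ∑ j : (T : Set I), Module.finrank ℚ (antiSpan G (Φ j)) := by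
    intro T hT
    by_contra hTbad
    exact Nat.find_min hex (hT₀card ▸ Finset.card_lt_card hT) ⟨T, rfl, hTbad⟩
  -- the common irreducible quotient
  obtain ⟨k, hk⟩ := exists_forall_evalSpace_ne_bot_of_minimal_nonadditive (V := fun k : K => S k.1) Φ
    (fun k => π k.1) (fun k => hirr k.1) (fun k l hkl T' => hne k.1 k.2 l.1 l.2 (fun h' => hkl (Subtype.ext h')) T')
    (fun j P _ hP0 hPst => by
      obtain ⟨k, hk, T', hT', a, ha, ha0⟩ := hcov j P hP0 hPst
      exact ⟨⟨k, hk⟩, T', hT', a, ha, ha0⟩) T₀ hT₀ hmin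
  -- `T₀` has at least two members (the empty and one-member families are additive)
  have hT₀2 : 2 ≤ T₀.card := by
    by_contra hsmall'
    have hsmall : ∀ i ∈ T₀, ∀ j ∈ T₀, i = j := fun i hi j hj =>
      Finset.card_le_one.1 (by omega) i hi j hj
    apply hT₀
    refine (hFT T₀).2 fun k' => ?_
    rcases T₀.eq_empty_or_nonempty with hT₀e | ⟨i₀, hi₀⟩
    · subst hT₀e
      haveI : IsEmpty ((∅ : Finset I) : Set I) := by simp
      rw [Fintype.sum_empty, iSup_of_empty, finrank_bot]
    · have hall : ∀ j : (T₀ : Set I), j = ⟨i₀, hi₀⟩ := fun j => Subtype.ext (hsmall j.1 j.2 i₀ hi₀)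
      haveI : Unique (T₀ : Set I) := ⟨⟨⟨i₀, hi₀⟩⟩, hall⟩
      rw [Fintype.sum_unique, iSup_unique]
  -- the balanced member `i ∈ T₀` and its vanishing sum of translates
  obtain ⟨i, hi, m, γ, hγ, hγ0⟩ := hbal T₀ hT₀2
  obtain ⟨Ti, hTi, hTi0, -⟩ :=
    exists_equivariant_map_top_of_evalSpace_ne_bot Φ (π k.1) (hirr k.1) i (hk i hi)
  -- the subgroup generated by the kernels of the other slots of `T₀` acts trivially on `V_k`
  have hplus : ∀ g ∈ Subgroup.closure {g : G | ∃ j ∈ T₀, j ≠ i ∧ ∀ s : E j, g • s = s},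
      ∀ v : S k.1, π k.1 g v = v := by
    intro g hg
    induction hg using Subgroup.closure_induction with
    | mem g hg =>
      obtain ⟨j, hj, -, hgj⟩ := hg
      obtain ⟨Tj, hTj, -, hTjtop⟩ :=
        exists_equivariant_map_top_of_evalSpace_ne_bot Φ (π k.1) (hirr k.1) j (hk j hj)
      intro v
      have hv : v ∈ (antiSpan G (Φ j)).map Tj := hTjtop ▸ Submodule.mem_top
      obtain ⟨f, -, rfl⟩ := hv
      rw [← hTj]
      congr 1
      funext s
      rw [(eq_inv_smul_iff.2 (hgj s)).symm]
    | one => intro v; rw [map_one, Module.End.one_apply]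
    | mul a b _ _ ha hb => intro v; rw [map_mul, Module.End.mul_apply, hb, ha]
    | inv a _ ha =>
      intro v
      have := congrArg (π k.1 a⁻¹) (ha v)
      rw [← Module.End.mul_apply, ← map_mul, inv_mul_cancel, map_one, Module.End.one_apply] at this
      exact this.symm
  -- `(m+1) • Ti(u_i) = Ti(Σ_k γ_k·u_i) = 0`
  apply hTi0
  set v := Ti (antiVec (Φ i) (1 : G)) with hv
  have h1 : ∑ k' : Fin (m + 1), π k.1 (γ k') v = ((m + 1 : ℕ) : ℚ) • v := by
    rw [Finset.sum_congr rfl fun k' _ => hplus (γ k') (hγ k') v, Finset.sum_const, Finset.card_univ, Fintype.card_fin,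
      Nat.cast_smul_eq_nsmul]
  have h2 : ∑ k' : Fin (m + 1), π k.1 (γ k') v = Ti (fun x => ∑ k' : Fin (m + 1), antiVec (Φ i) (1 : G) ((γ k')⁻¹ • x)) := by
    rw [hv]
    have : (fun x => ∑ k' : Fin (m + 1), antiVec (Φ i) (1 : G) ((γ k')⁻¹ • x)) =
        ∑ k' : Fin (m + 1), fun x => antiVec (Φ i) (1 : G) ((γ k')⁻¹ • x) := by
      funext x
      simp only [Finset.sum_apply]
    rw [this, map_sum]
    exact Finset.sum_congr rfl fun k' _ => (hTi (γ k') (antiVec (Φ i) (1 : G))).symm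
  have h3 : (fun x => ∑ k' : Fin (m + 1), antiVec (Φ i) (1 : G) ((γ k')⁻¹ • x)) = 0 := by
    funext x
    exact hγ0 x
  have hnv : ((m + 1 : ℕ) : ℚ) • v = 0 := by rw [← h1, h2, h3, map_zero]
  rcases smul_eq_zero.1 hnv with h | h
  · exact absurd h (by positivity)
  · exact h

omit [DecidableEq I] in
/-- **FAMILY ADDITIVITY, PAIRWISE KERNEL FORM.**  If for every pair of slots `i ≠ j` ONE of the two type vectors, say
`u_1(Φ_i)`, has a vanishing non-empty sum of translates `Σ_k γ_k·u_1(Φ_i) = 0` by elements `γ_k` acting TRIVIALLY on the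
other slot `E_j`, then `dim U(Σ) = Σ_i dim U(Φ_i)` — `Hg(∏_i A_i) = ∏_i Hg(A_i)`, arbitrary subsets `Φ_i`.  Gen 59 F10
(«pairwise `ρ`-separated slots») is the two-term case `u + τ·u = 0`.
[cite: Gordon1999HodgeAVSurvey, §3 Theorem (proof) and 7.7] [cite: MoonenZarhin1999LowDim, §3 (3.1)] [cite: Mai1989, §2 Prop. 1 (proof)] -/
theorem finrank_antiSpan_sigmaType_eq_sum_of_pairwise_kernel {Φ : ∀ i, Set (E i)}
    (hbal : ∀ i j : I, i ≠ j →
      (∃ (n : ℕ) (γ : Fin (n + 1) → G), (∀ k (s : E j), γ k • s = s) ∧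
        ∀ x : E i, ∑ k, antiVec (Φ i) (1 : G) ((γ k)⁻¹ • x) = 0) ∨
      (∃ (n : ℕ) (γ : Fin (n + 1) → G), (∀ k (s : E i), γ k • s = s) ∧
        ∀ y : E j, ∑ k, antiVec (Φ j) (1 : G) ((γ k)⁻¹ • y) = 0)) :
    Module.finrank ℚ (antiSpan G (sigmaType Φ)) = ∑ i, Module.finrank ℚ (antiSpan G (Φ i)) := by
  classical
  refine finrank_antiSpan_sigmaType_eq_sum_of_closure_kernels fun T hT => ?_
  obtain ⟨i, hi, j, hj, hij⟩ : ∃ i ∈ T, ∃ j ∈ T, i ≠ j := by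
    by_contra hsmall
    push Not at hsmall
    exact absurd (Finset.card_le_one.2 hsmall) (by omega)
  have key : ∀ i ∈ T, ∀ j ∈ T, i ≠ j → ∀ (n : ℕ) (γ : Fin (n + 1) → G), (∀ k (s : E j), γ k • s = s) →
      (∀ x : E i, ∑ k, antiVec (Φ i) (1 : G) ((γ k)⁻¹ • x) = 0) →
      ∃ i ∈ T, ∃ (n : ℕ) (γ : Fin (n + 1) → G),
        (∀ k, γ k ∈ Subgroup.closure {g : G | ∃ j ∈ T, j ≠ i ∧ ∀ s : E j, g • s = s}) ∧
        ∀ x : E i, ∑ k, antiVec (Φ i) (1 : G) ((γ k)⁻¹ • x) = 0 :=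
    fun i hi j hj hij n γ hγ hγ0 =>
      ⟨i, hi, n, γ, fun k => Subgroup.subset_closure ⟨j, hj, hij.symm, hγ k⟩, hγ0⟩
  rcases hbal i j hij with ⟨n, γ, hγ, hγ0⟩ | ⟨n, γ, hγ, hγ0⟩
  · exact key i hi j hj hij n γ hγ hγ0
  · exact key j hj i hi hij.symm n γ hγ hγ0

omit [DecidableEq I] in
/-- **FAMILY ADDITIVITY, PAIRWISE ORBIT FORM.**  If for every pair `i ≠ j` one of the two types, say `Φ_i`, is
EQUIDISTRIBUTED along the orbits on `E_i` of some subgroup `H` acting trivially on `E_j` (every `H`-orbit meets `Φ_i` in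
exactly half of its points: `Σ_{y ∈ Hx} u_1(Φ_i)(y) = 0`), then `dim U(Σ) = Σ_i dim U(Φ_i)` (`Hg(∏_i A_i) = ∏_i Hg(A_i)`).
For `G = Aut(ℂ)`, `H = Aut(ℂ/L_j)` (`L_j` the Galois closure of `K_j`): «`Φ_i` is equidistributed over `K_i ∩ L_j`».
[cite: Gordon1999HodgeAVSurvey, §3 Theorem (proof) and 7.7] [cite: MoonenZarhin1999LowDim, §3 (3.1)] -/
theorem finrank_antiSpan_sigmaType_eq_sum_of_pairwise_orbit_sums_eq_zero {Φ : ∀ i, Set (E i)}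
    (hbal : ∀ i j : I, i ≠ j →
      (∃ H : Subgroup G, (∀ g ∈ H, ∀ s : E j, g • s = s) ∧ ∀ x : E i, ∃ s : Finset (E i),
        (∀ y, y ∈ s ↔ y ∈ MulAction.orbit H x) ∧ ∑ y ∈ s, antiVec (Φ i) (1 : G) y = 0) ∨
      (∃ H : Subgroup G, (∀ g ∈ H, ∀ s : E i, g • s = s) ∧ ∀ y : E j, ∃ s : Finset (E j),
        (∀ z, z ∈ s ↔ z ∈ MulAction.orbit H y) ∧ ∑ z ∈ s, antiVec (Φ j) (1 : G) z = 0)) :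
    Module.finrank ℚ (antiSpan G (sigmaType Φ)) = ∑ i, Module.finrank ℚ (antiSpan G (Φ i)) := by
  refine finrank_antiSpan_sigmaType_eq_sum_of_pairwise_kernel fun i j hij => ?_
  rcases hbal i j hij with ⟨H, hH, hb⟩ | ⟨H, hH, hb⟩
  · obtain ⟨n, γ, hγ, hγ0⟩ := exists_translates_sum_eq_zero_of_orbit_sums_eq_zero H (antiVec (Φ i) (1 : G)) hb
    exact Or.inl ⟨n, γ, fun k s => hH (γ k) (hγ k) s, hγ0⟩
  · obtain ⟨n, γ, hγ, hγ0⟩ := exists_translates_sum_eq_zero_of_orbit_sums_eq_zero H (antiVec (Φ j) (1 : G)) hb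
    exact Or.inr ⟨n, γ, fun k s => hH (γ k) (hγ k) s, hγ0⟩

omit [Fintype I] [DecidableEq I] [∀ i, Fintype (E i)] in
/-- **Recovery of gen 59 F10**: pairwise `ρ`-separated slots (`τ` acts as `ρ` on `E_i`, trivially on `E_j`) satisfy the
pairwise kernel hypothesis with the two-term sum `u + τ·u = 0`. [cite: Gordon1999HodgeAVSurvey, §3 Theorem (proof)] -/
theorem pairwise_kernel_of_pairwise_separated {ρ : G} {Φ : ∀ i, Set (E i)} (h : ∀ i, IsCMTypeWith ρ (Φ i))
    (hsep : ∀ i j : I, i ≠ j → ∃ τ : G, (∀ s : E i, τ • s = ρ • s) ∧ ∀ s : E j, τ • s = s) :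
    ∀ i j : I, i ≠ j →
      (∃ (n : ℕ) (γ : Fin (n + 1) → G), (∀ k (s : E j), γ k • s = s) ∧
        ∀ x : E i, ∑ k, antiVec (Φ i) (1 : G) ((γ k)⁻¹ • x) = 0) ∨
      (∃ (n : ℕ) (γ : Fin (n + 1) → G), (∀ k (s : E i), γ k • s = s) ∧
        ∀ y : E j, ∑ k, antiVec (Φ j) (1 : G) ((γ k)⁻¹ • y) = 0) := by
  intro i j hij
  obtain ⟨τ, hτi, hτj⟩ := hsep i j hij
  obtain ⟨n, γ, hγ, hγ0⟩ := exists_translates_sum_eq_zero_of_smul_eq_rho (h i)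
    (H := (MulAction.toPermHom G (E j)).ker) (g := τ)
    (by
      rw [MonoidHom.mem_ker]
      ext s
      exact hτj s)
    hτi
  refine Or.inl ⟨n, γ, fun k s => ?_, hγ0⟩
  have hk := hγ k
  rw [MonoidHom.mem_ker] at hk
  exact congrFun (congrArg (fun (e : Equiv.Perm (E j)) => (e : E j → E j)) hk) s

omit [DecidableEq I] in
/-- **Rank form**: pairwise kernel translates ⟹ `rank(Σ) + |I| = Σ_i rank(Φ_i) + 1` (`dim MT(∏ A_i) − 1 = Σ (dim MT(A_i) − 1)`).
[cite: Gordon1999HodgeAVSurvey, §3 Theorem and 7.7] [cite: MoonenZarhin1999LowDim, §3 (3.1)] -/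
theorem typeRank_sigmaType_add_card_eq_of_pairwise_kernel [Nonempty I] [∀ i, Nonempty (E i)] {ρ : G}
    {Φ : ∀ i, Set (E i)} (h : ∀ i, IsCMTypeWith ρ (Φ i))
    (hbal : ∀ i j : I, i ≠ j →
      (∃ (n : ℕ) (γ : Fin (n + 1) → G), (∀ k (s : E j), γ k • s = s) ∧
        ∀ x : E i, ∑ k, antiVec (Φ i) (1 : G) ((γ k)⁻¹ • x) = 0) ∨
      (∃ (n : ℕ) (γ : Fin (n + 1) → G), (∀ k (s : E i), γ k • s = s) ∧
        ∀ y : E j, ∑ k, antiVec (Φ j) (1 : G) ((γ k)⁻¹ • y) = 0)) :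
    typeRank G (sigmaType Φ) + Fintype.card I = (∑ i, typeRank G (Φ i)) + 1 :=
  (typeRank_sigmaType_add_card_eq_iff_finrank_eq h).2 (finrank_antiSpan_sigmaType_eq_sum_of_pairwise_kernel hbal)

omit [DecidableEq I] in
/-- **Pairwise kernel translates: the family is nondegenerate iff every member is.**
[cite: Gordon1999HodgeAVSurvey, §3 Theorem (2) and 7.5] -/
theorem typeRank_sigmaType_eq_iff_forall_of_pairwise_kernel [Nonempty I] [∀ i, Nonempty (E i)] {ρ : G}
    {Φ : ∀ i, Set (E i)} (h : ∀ i, IsCMTypeWith ρ (Φ i))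
    (hbal : ∀ i j : I, i ≠ j →
      (∃ (n : ℕ) (γ : Fin (n + 1) → G), (∀ k (s : E j), γ k • s = s) ∧
        ∀ x : E i, ∑ k, antiVec (Φ i) (1 : G) ((γ k)⁻¹ • x) = 0) ∨
      (∃ (n : ℕ) (γ : Fin (n + 1) → G), (∀ k (s : E i), γ k • s = s) ∧
        ∀ y : E j, ∑ k, antiVec (Φ j) (1 : G) ((γ k)⁻¹ • y) = 0)) :
    typeRank G (sigmaType Φ) = Fintype.card (Σ i, E i) / 2 + 1 ↔
      ∀ i, typeRank G (Φ i) = Fintype.card (E i) / 2 + 1 := by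
  have hsum := typeRank_sigmaType_add_card_eq_of_pairwise_kernel h hbal
  have hle : ∀ i, typeRank G (Φ i) ≤ Fintype.card (E i) / 2 + 1 := fun i => (h i).typeRank_le
  have htot : ∑ j, (Fintype.card (E j) / 2 + 1) = (∑ j, Fintype.card (E j) / 2) + Fintype.card I := by
    rw [Finset.sum_add_distrib, Finset.sum_const, Finset.card_univ, smul_eq_mul, mul_one]
  rw [card_sigma_div_two h]
  constructor
  · intro hS i
    by_contra hne
    have hlt : typeRank G (Φ i) < Fintype.card (E i) / 2 + 1 := lt_of_le_of_ne (hle i) hne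
    have hsum_lt : ∑ j, typeRank G (Φ j) < ∑ j, (Fintype.card (E j) / 2 + 1) :=
      Finset.sum_lt_sum (fun j _ => hle j) ⟨i, Finset.mem_univ i, hlt⟩
    rw [htot] at hsum_lt
    omega
  · intro hall
    have hsum_eq : ∑ j, typeRank G (Φ j) = ∑ j, (Fintype.card (E j) / 2 + 1) := Finset.sum_congr rfl fun j _ => hall j
    rw [htot] at hsum_eq
    omega

end IrrOdd

end Summit.HodgeConjecture.CorCM

end
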